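import Literature.NumberTheory.Automorphic.JacquetModuleExactProofs
import HarnessLib

/-!
# Exactness of the Jacquet functor: the corrected (closed) named fact

The named fact `Representation.jacquet_exact` of `Literature.NumberTheory.Automorphic.JacquetModule`
(Bernstein–Zelevinsky 1976, Prop. 2.35) is **mis-stated**: it was written in a section declaring
`[Field k] [CharZero k] … [IsTopologicalGroup G]`, but a `def` only absorbs the section variables
its body uses, so `[CharZero k]` and `[IsTopologicalGroup G]` were silently dropped and the
registered constant is `Representation.jacquet_exact.{u₁,…,u₅} : ∀ {k G} [Field k] [Group G]
[TopologicalSpace G], Prop`, quantifying over fields of every characteristic. That constant is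
**false** (`Representation.not_jacquet_exact`, file `JacquetExactCounterexample`: over `𝔽₂` the
Jacquet functor of `(∏_ℕ ℤ/2ℤ, 1, ∏_ℕ ℤ/2ℤ)` kills the injection `𝔽₂ → 𝔽₂ ⊕ 𝔽₂^{(ℕ)}`).
Accordingly the theorem `Representation.jacquet_exact_holds` of `JacquetModuleExactProofs`
(whose mathematics is correct) carries the two extra instance binders `[CharZero k]
[IsTopologicalGroup G]` relative to the constant: it is the *intended* theorem, a conditional form
of the registered fact, not a discharge of it.

This file vendors the intended statement as a **fully closed** named fact
`Representation.jacquet_exact_of_charZero` (the types `k, G, V₁, V₂, V₃` and all instance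
hypotheses, including `[CharZero k]` and `[IsTopologicalGroup G]`, are binders *inside* the
`Prop`, so nothing can be dropped) and discharges it by the theorems of `JacquetModuleExactProofs`
(`Representation.jacquetMap_injective`, `Representation.jacquetMap_exact`,
`Representation.jacquetMap_surjective`): `Representation.jacquet_exact_of_charZero_holds`.

## References

* I. N. Bernstein, A. V. Zelevinsky, *Representations of the group `GL(n, F)` where `F` is a
  non-archimedean local field*, Russian Math. Surveys 31 (1976), Prop. 2.35 (locator as recorded
  on the vendored fact; not held).
* I. N. Bernstein, A. V. Zelevinsky, *Induced representations of reductive `p`-adic groups I*,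
  Ann. Sci. ÉNS 10 (1977), Prop. 1.9(a) ("if `U` is a limit of compact subgroups, then `r_{U,θ}`
  is exact") and Prop. 2.3(a) (held; read).
* W. Casselman, *Introduction to the theory of admissible representations of `p`-adic reductive
  groups*, draft 1 May 1995, Prop. 3.2.3, p. 34 (exactness of `V ↦ V_N` on smooth `N`-spaces).
-/

namespace Representation

open Literature.NumberTheory.Automorphic

section CorrectedFact

universe u v w₁ w₂ w₃

/-- **Exactness of the Jacquet functor (corrected named fact).** For `k` a field of
characteristic `0` and `G` a topological group: if `t = (P, M, N)` is a parabolic triple with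
`N` a limit (union) of compact open subgroups, then for every short exact sequence
`0 → ρ₁ → ρ₂ → ρ₃ → 0` of smooth representations of `G` on `k`-modules the sequence of Jacquet
modules `0 → r_P ρ₁ → r_P ρ₂ → r_P ρ₃ → 0` is exact.
(Bernstein–Zelevinsky 1976, Prop. 2.35; Bernstein–Zelevinsky 1977, Prop. 1.9(a), 2.3(a);
Casselman 1995, Prop. 3.2.3.)

This is the statement `Representation.jacquet_exact` was *meant* to be (see the module docstring:
that constant lost `[CharZero k] [IsTopologicalGroup G]` and is false,
`Representation.not_jacquet_exact`). Fully closed; discharged by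
`jacquet_exact_of_charZero_holds`. [cite: BernsteinZelevinsky1976, Prop. 2.35] -/
def jacquet_exact_of_charZero : Prop :=
  ∀ {k : Type u} {G : Type v} [Field k] [CharZero k] [Group G] [TopologicalSpace G]
    [IsTopologicalGroup G] {V₁ : Type w₁} {V₂ : Type w₂} {V₃ : Type w₃} [AddCommGroup V₁]
    [Module k V₁] [AddCommGroup V₂] [Module k V₂] [AddCommGroup V₃] [Module k V₃]
    {ρ₁ : Representation k G V₁} {ρ₂ : Representation k G V₂} {ρ₃ : Representation k G V₃}
    (t : ParabolicTriple G) (_ : IsLimitOfCompactOpen t.N) (_ : ρ₁.IsSmooth) (_ : ρ₂.IsSmooth)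
    (_ : ρ₃.IsSmooth) (f : ρ₁.IntertwiningMap ρ₂) (g : ρ₂.IntertwiningMap ρ₃)
    (_ : Function.Injective f) (_ : Function.Exact f g) (_ : Function.Surjective g),
    Function.Injective (jacquetMap t f) ∧ Function.Exact (jacquetMap t f) (jacquetMap t g) ∧
      Function.Surjective (jacquetMap t g)

/-- **Discharge of `jacquet_exact_of_charZero`** by the theorems of `JacquetModuleExactProofs`
(finite averaging over `N₀ / S`, Bernstein–Zelevinsky 1976, Prop. 2.35; 1977, Prop. 1.9(a)).
[cite: BernsteinZelevinsky1976, Prop. 2.35] -/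
theorem jacquet_exact_of_charZero_holds : jacquet_exact_of_charZero :=
  fun t hN _ h₂ _ f g hf hfg hg =>
    ⟨jacquetMap_injective t hN h₂ f hf, jacquetMap_exact t f g hfg hg, jacquetMap_surjective t g hg⟩

/-- `Representation.jacquet_exact_holds` (`JacquetModuleExactProofs`) is exactly the universe- and
instance-specialised corrected fact: under `[CharZero k] [IsTopologicalGroup G]` the registered
constant `jacquet_exact` follows from `jacquet_exact_of_charZero`. [folklore] -/
theorem jacquet_exact_of_jacquet_exact_of_charZero {k : Type u} {G : Type v} [Field k]
    [CharZero k] [Group G] [TopologicalSpace G] [IsTopologicalGroup G]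
    (h : jacquet_exact_of_charZero.{u, v, w₁, w₂, w₃}) :
    jacquet_exact.{u, v, w₁, w₂, w₃} (k := k) (G := G) :=
  fun t hN h₁ h₂ h₃ f g hf hfg hg => h t hN h₁ h₂ h₃ f g hf hfg hg

end CorrectedFact

end Representation
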